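import Summits.AtomisticToContinuum.HydrodynamicLimit.Theses.JParityClosure
import Summits.AtomisticToContinuum.HydrodynamicLimit.Theorems.LocalSecondLaw.Negative.HomogeneousLLN
import Summits.AtomisticToContinuum.HydrodynamicLimit.Theorems.DenseExcursion.Negative.Untied

/-!
# Negative knowledge for crux `JParityClosure.OddContactSymmetry` (stmt-AtomisticToContinuum-17722, rev 5):
# the pre-shock frame is void at rung 0 — the restated crux still claims EVERY horizon at global equilibrium

Standing disprover `refuter-cdisprove-stmt-AtomisticToContinuum-17722-0` (cycle 1, 2026-08-17), companion of
`Cruxes/OddContactSymmetry/Disproof.lean` §9 (load-bearing analysis of the hypotheses INSERTED at rev 5: a classical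
hard-sphere-Euler solution `(ρ,u,θ)` on `[0,T)`, the `t = 0` law of large numbers tying the local Gibbs data to it, and
the shock clock `τ < T`).  At the homogeneous profiles `(a₀, u₀, θ₀) = (1, 0, θ₀)` all three are dischargeable in tree for
EVERY horizon: the constant state `(1, 0, θ₀)` is a classical solution on `[0, τ+1)` for every `τ`
(`DenseExcursionUntied.isHardSphereEulerSolution_const`, all derivatives vanish whatever the equation of state) and the
local Gibbs fields converge to it at `t = 0` through every flow family (`LocalSecondLawNegative.homogeneous_lln_identified`,
from the tree's PROVED local Gibbs LLN).  Hence: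

* `OddStatRungZeroAllTimes` — the crux body VERBATIM (Metropolis weight, cone/Gaussian mollifiers, `F`, `K_N`, the
  `∀ η δ ∃ r₀ ∀ r ϑ ∃ N₀` order) at the profiles `(1, 0, θ₀)`, with NO Euler solution, NO LLN hypothesis and NO shock clock:
  every `τ > 0`;
* `oddContactSymmetry_imp_rungZeroAllTimes : OddContactSymmetry → OddStatRungZeroAllTimes` — the rev-5 frame restricts
  nothing at global equilibrium (there is no first shock: `T` is at the refuter's disposal);
* `not_oddContactSymmetry_of_not_rungZeroAllTimes` — the kill recipe that survives the restatement: ANY equilibrium anomaly of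
  the Metropolis-weighted odd statistic at ANY fixed horizon `τ` (however long, e.g. `≳ N^{a}` mean free times in macroscopic
  units are NOT needed — `τ` is fixed — but every fixed `τ` already spans `≍ (N+1)^{1/3}` mean free times) refutes the rev-5
  crux.  The velocity-hole blow-up that killed the retired rev-1 weight `1 + e^{−F}` at rung 0 (Disproof §7,
  `VelocityHoleWeight`, `TailBlowupAndCutoff`) is clipped by `min 1 ·`; what remains at rung 0 is KDE consistency + static
  `J`-parity + collision-count tightness (the lead's rung-0 assembly), for all `τ`.
-/

noncomputable section

namespace Summit.AtomisticToContinuum.HydrodynamicLimit.Theorems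

namespace OddContactSymmetryNegative

open Summit.AtomisticToContinuum.HydrodynamicLimit.Theses.JParityClosure
open Literature.Analysis.FluidPDE Literature.MathematicalPhysics.KineticTheory

/-- **Rung 0 of the rev-5 crux, every horizon.**  `OddContactSymmetry` (stmt-17722) with the profiles specialised to the
homogeneous state `(a₀, u₀, θ₀) = (1, 0, θ₀)`, `θ₀ > 0` constant, and the three rev-5 insertions (classical solution, `t = 0`
LLN, `τ < T`) DELETED; the `let`-chain (mollifiers `bx`, `ρm`, `hm`, pre-velocities `pv`, surprisal jump `F`, normalised
collision functional `Kc`, Metropolis-weighted odd statistic `D`) is byte-identical to the route declaration.  (A crux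
specialisation, not a cited fact: no cite tag, nothing to relocate.) -/
def OddStatRungZeroAllTimes : Prop :=
  ∃ η₀ : ℝ, 0 < η₀ ∧ ∀ θ₀ : ℝ, 0 < θ₀ → ∃ σ₀ : ℝ, 0 < σ₀ ∧ ∀ σ : ℝ, 0 < σ → σ < σ₀ → ∀ Φ : (N : ℕ) → Literature.Analysis.FluidPDE.HardSphereFlow (Literature.Analysis.FluidPDE.Torus.geometry (Fin 3)) (Literature.MathematicalPhysics.KineticTheory.hsDiameter σ N) (N + 1), ∀ τ : ℝ, 0 < τ → ∀ χ : ℝ × UnitAddTorus (Fin 3) → ℝ, Continuous χ → ∀ g : ℝ → ℝ, Continuous g → (∀ a, η₀ ≤ a → g a = 0) → ∀ Ψ : EuclideanSpace ℝ (Fin 3) × EuclideanSpace ℝ (Fin 3) × EuclideanSpace ℝ (Fin 3) → ℝ, Continuous Ψ → (∃ C : ℝ, ∀ q, |Ψ q| ≤ C) → (∀ (n v w : EuclideanSpace ℝ (Fin 3)), ‖n‖ = 1 → Ψ (-n, (Literature.Analysis.FluidPDE.reflectVel n (v, w)).1, (Literature.Analysis.FluidPDE.reflectVel n (v, w)).2)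 = -Ψ (n, v, w)) → ∀ η δ : ℝ, 0 < η → 0 < δ → ∃ r₀ : ℝ, 0 < r₀ ∧ ∀ r ϑ : ℝ, 0 < r → r < r₀ → 0 < ϑ → ϑ < r₀ → ∃ N₀ : ℕ, ∀ N : ℕ, N₀ ≤ N → let ε := Literature.MathematicalPhysics.KineticTheory.hsDiameter σ N; let G := Literature.Analysis.FluidPDE.Torus.geometry (Fin 3); let γ := fun z (s : ℝ) => (Φ N).flow s z; let bx : UnitAddTorus (Fin 3) → UnitAddTorus (Fin 3) → ℝ := fun x y => 3 / (Real.pi * r ^ 3) * max (1 - Literature.Analysis.FluidPDE.Torus.euclidDist x y / r) 0; let ρm := fun z s (x₀ : UnitAddTorus (Fin 3)) => ∫ q, bx q.1 x₀ ∂(Literature.Analysis.FluidPDE.empiricalMeasure (γ z s)); let hm := fun z s (x₀ : UnitAddTorus (Fin 3)) (v : EuclideanSpace ℝ (Fin 3)) => ∫ q, bx q.1 x₀ * Literature.Analysis.FluidPDE.localMaxwellian 1 (ϑ ^ 2) v q.2 ∂(Literature.Analysis.FluidPDE.empiricalMeasure (γ z s)); let pv := fun z s (i j : Fin (N + 1))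 => Literature.Analysis.FluidPDE.reflectVel (G.sepVec (γ z s i).1 (γ z s j).1) ((γ z s i).2, (γ z s j).2); let F := fun z s (i j : Fin (N + 1)) => Real.log (hm z s (γ z s i).1 (pv z s i j).1) + Real.log (hm z s (γ z s i).1 (pv z s i j).2) - Real.log (hm z s (γ z s i).1 (γ z s i).2) - Real.log (hm z s (γ z s i).1 (γ z s j).2); let Kc := fun (Fn : Literature.Analysis.FluidPDE.Config (N + 1) (Fin 3) Literature.MathematicalPhysics.KineticTheory.T3 → ℝ → Fin (N + 1) → Fin (N + 1) → ℝ) z => ε / (N + 1 : ℝ) * ∑ᶠ (s : ℝ) (_ : s ∈ Literature.Analysis.FluidPDE.collisionTimes G ε (γ z) ∩ Set.Icc 0 τ), ∑ i : Fin (N + 1), ∑ j : Fin (N + 1), (if i ≠ j ∧ ‖G.sepVec (γ z s i).1 (γ z s j).1‖ = ε then Fn z s i j else 0); let D := fun z => Kc (fun z s i j => χ (s, (γ z s i).1) * g (σ ^ 3 * ρm z s (γ z s i).1) * (Ψ (ε⁻¹ • G.sepVec (γ z s i).1 (γ z s j).1, (pv z s i j).1, (pv z s i j).2) * min 1 (Real.exp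 (-F z s i j)))) z; Literature.MathematicalPhysics.KineticTheory.localGibbsLaw σ (fun _ => 1) (fun _ => 0) (fun _ => θ₀) N (Φ N) {z | η < |D z|} ≤ ENNReal.ofReal δ

/-- **The pre-shock frame is void at rung 0**: the rev-5 crux implies its frame-free equilibrium specialisation for EVERY
horizon `τ > 0` — instantiate `T := τ + 1`, the constant classical solution `(1, 0, θ₀)`
(`isHardSphereEulerSolution_const`) and the identified `t = 0` LLN (`homogeneous_lln_identified`), shrinking `σ₀` below
the LLN's `σ₁`.  So the hypotheses inserted at rev 5 are NOT load-bearing at global equilibrium. [folklore] -/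
theorem oddContactSymmetry_imp_rungZeroAllTimes (h : OddContactSymmetry) : OddStatRungZeroAllTimes := by
  obtain ⟨η₀, hη₀, H⟩ := h
  refine ⟨η₀, hη₀, fun θ₀ hθ₀ => ?_⟩
  obtain ⟨σ₀, hσ₀, Hσ⟩ := H (fun _ => 1) (fun _ => θ₀) (fun _ => 0) continuous_const continuous_const
    continuous_const (fun _ => one_pos) (fun _ => hθ₀)
  obtain ⟨σ₁, hσ₁, -, hL⟩ := LocalSecondLawNegative.homogeneous_lln_identified hθ₀
  refine ⟨min σ₀ σ₁, lt_min hσ₀ hσ₁, fun σ hσ hσlt Φ τ hτ => ?_⟩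
  have hσ0 : σ < σ₀ := lt_of_lt_of_le hσlt (min_le_left _ _)
  have hσ1 : σ < σ₁ := lt_of_lt_of_le hσlt (min_le_right _ _)
  exact Hσ σ hσ hσ0 (τ + 1) (fun _ _ => 1) (fun _ _ => θ₀) (fun _ _ => 0)
    (DenseExcursionUntied.isHardSphereEulerSolution_const σ (τ + 1) (0 : V3) one_pos hθ₀) Φ (hL σ hσ hσ1 Φ) τ hτ
    (by linarith)

/-- **Kill recipe surviving the restatement**: an equilibrium anomaly of the Metropolis-weighted odd statistic at some fixed
horizon refutes the rev-5 crux (contrapositive of `oddContactSymmetry_imp_rungZeroAllTimes`). [folklore] -/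
theorem not_oddContactSymmetry_of_not_rungZeroAllTimes (h : ¬ OddStatRungZeroAllTimes) : ¬ OddContactSymmetry :=
  fun hc => h (oddContactSymmetry_imp_rungZeroAllTimes hc)

end OddContactSymmetryNegative

end Summit.AtomisticToContinuum.HydrodynamicLimit.Theorems

end
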